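import Mathlib.Algebra.MvPolynomial.PDeriv
import Mathlib.Analysis.Complex.Basic
import Mathlib.Tactic
import Literature.Combinatorics.StablePolynomials.Limits
import HarnessLib

/-!
# The Y-head LEVEL polynomial of THEOREM MT is zero or stable — Lemma SR without BBL Lemma 4.16

Support file for the Sahi / Conjecture-P programme of route `PercNearOneGluingNoHeavy`
(`--supports stmt-CriticalPhenomena-4575`, prover prim-l12-p5 gen 30; proof note
`prim-l12-p5/MULTITYPE-PROOF-g30.md` §2 Lemma SR, and `prim-l12-p5/LEAN-ROADMAP-MT-g30.md` §3).
No definitions, no named facts, no sorries.  Companion of `…LowerTailYHeadStable`.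

Lemma SR of THEOREM MT: in the site model (sites `s ∈ S`, weights `(1, p_s, q_s)` for the states
`0 / X / Y`), the law of the set of `Y`-sites at quotas `(#X, #Y) = (a, c)` has generating polynomial
proportional to the part of `[u^a] ∏_s (1 + p_s u + q_s t_s)` that is homogeneous of degree `c` in the
`t_s`.  The note obtains its stability from BBL 2009 Lemma 4.16 (homogeneous parts of stable
polynomials with non-negative coefficients).  For THIS polynomial no such theorem is needed: the
HOMOGENISATION `P_H = ∏_s (y + p_s u + q_s t_s)` is itself a product of stable linear forms, and the
`(u^a, y^b)`-coefficient of `P_H` — which for `b = |S| − a − c` is exactly the degree-`c` part of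
`[u^a] ∏_s (1 + p_s u + q_s t_s)` — is `(a! b!)⁻¹ ∂_u^a ∂_y^b P_H |_{u = y = 0}`, zero or stable by the
closure of stability under partial derivatives and real specialisation (Wagner, Lemma 2.4 (d),(f), as
formalised in `Literature.Combinatorics.StablePolynomials.Limits`).

Variables: `Option (Option S)` with `none` = `y`, `some none` = `u`, `some (some s)` = `t_s`.

* `homSiteFactor_stable`, `homSiteProduct_stable` : `y + p u + q t_s` and their product are stable;
* `iterate_pderiv_zero` : `(∂_i)^[k] 0 = 0`;
* `yHeadLevel_zero_or_stable` : `(∂_y^b ∂_u^a P_H)|_{u := 0, y := 0}` is zero or stable — hence (when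
  non-zero) the `Y`-head set at quotas `(a, |S|−a−b)` is strongly Rayleigh.
-/

namespace Summit.CriticalPhenomena.PercolationContinuityZ3.Theorems

namespace YHeadLevelStable

open MvPolynomial Literature.Combinatorics.StablePolynomials

variable {S : Type*}

/-- **A homogenised site factor is stable**: for `p, q ≥ 0`, `y + p·u + q·t_s` does not vanish when
`Im y, Im u, Im t_s > 0` (its imaginary part is at least `Im y > 0`). -/
theorem homSiteFactor_stable (s : S) {p q : ℝ} (hp : 0 ≤ p) (hq : 0 ≤ q) :
    IsUpperHalfPlaneStable
      (X none + C (p : ℂ) * X (some none) + C (q : ℂ) * X (some (some s)) :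
        MvPolynomial (Option (Option S)) ℂ) := by
  intro z hz h
  simp only [map_add, map_mul, eval_C, eval_X] at h
  have him := congrArg Complex.im h
  simp only [Complex.add_im, Complex.mul_im, Complex.ofReal_re, Complex.ofReal_im, zero_mul, add_zero,
    Complex.zero_im] at him
  have h1 : 0 ≤ p * (z (some none)).im := mul_nonneg hp (hz (some none)).le
  have h2 : 0 ≤ q * (z (some (some s))).im := mul_nonneg hq (hz (some (some s))).le
  have h3 : 0 < (z none).im := hz none
  linarith

/-- **The homogenised site product `∏_s (y + p_s u + q_s t_s)` is stable** for non-negative weights. -/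
theorem homSiteProduct_stable [Fintype S] (p q : S → ℝ) (hp : ∀ s, 0 ≤ p s) (hq : ∀ s, 0 ≤ q s) :
    IsUpperHalfPlaneStable
      (∏ s, (X none + C (p s : ℂ) * X (some none) + C (q s : ℂ) * X (some (some s))) :
        MvPolynomial (Option (Option S)) ℂ) :=
  isUpperHalfPlaneStable_prod Finset.univ fun s _ => homSiteFactor_stable s (hp s) (hq s)

/-- Iterated partial derivatives of the zero polynomial vanish. -/
theorem iterate_pderiv_zero {σ : Type*} (i : σ) (k : ℕ) :
    (pderiv i)^[k] (0 : MvPolynomial σ ℂ) = 0 := by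
  induction k with
  | zero => rfl
  | succ k ih => rw [Function.iterate_succ_apply', ih, map_zero]

/-- **The Y-head level polynomial is zero or stable** (Lemma SR of THEOREM MT, unconditionally):
with `P_H = ∏_s (y + p_s u + q_s t_s)`, the polynomial `(∂_y^b ∂_u^a P_H)|_{u := 0, y := 0}` in the
variables `t_s` — equal to `a!·b!` times the part of `[u^a]∏_s(1 + p_s u + q_s t_s)` of `t`-degree
`|S| − a − b` — is identically zero or stable. -/
theorem yHeadLevel_zero_or_stable [Fintype S] [DecidableEq S] (p q : S → ℝ) (hp : ∀ s, 0 ≤ p s)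
    (hq : ∀ s, 0 ≤ q s) (a b : ℕ) :
    bind₁ (Function.update X none (C ((0 : ℝ) : ℂ)))
        (bind₁ (Function.update X (some none) (C ((0 : ℝ) : ℂ)))
          ((pderiv none)^[b] ((pderiv (some none))^[a]
            (∏ s, (X none + C (p s : ℂ) * X (some none) + C (q s : ℂ) * X (some (some s))) :
              MvPolynomial (Option (Option S)) ℂ)))) = 0 ∨
      IsUpperHalfPlaneStable
        (bind₁ (Function.update X none (C ((0 : ℝ) : ℂ)))
          (bind₁ (Function.update X (some none) (C ((0 : ℝ) : ℂ)))
            ((pderiv none)^[b] ((pderiv (some none))^[a]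
              (∏ s, (X none + C (p s : ℂ) * X (some none) + C (q s : ℂ) * X (some (some s))) :
                MvPolynomial (Option (Option S)) ℂ))))) := by
  -- ∂_u^a
  rcases (homSiteProduct_stable p q hp hq).iterate_pderiv (some none) a with h1 | h1
  · left
    rw [h1, iterate_pderiv_zero, map_zero, map_zero]
  -- ∂_y^b
  rcases h1.iterate_pderiv none b with h2 | h2
  · left
    rw [h2, map_zero, map_zero]
  -- u := 0
  rcases h2.specialize_real (some none) 0 with h3 | h3
  · left
    rw [h3, map_zero]
  -- y := 0
  exact h3.specialize_real none 0

end YHeadLevelStable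

end Summit.CriticalPhenomena.PercolationContinuityZ3.Theorems
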